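import Summits.KontsevichZagierPeriods.KontsevichZagierPeriods.Theorems.RootDecompWalshStrataOctantArc

/-!
# The pointless octant, part 4/4: the absorption chart — into the Baker sector

The ABSORPTION chart `t = u/√7` (`of_absRep_sub_of_arcRep_mem_relations`, rule (2) with Jacobian
`1/√7`) lands on `absRep = [(0,√7), 49/(96(7+u²))]`, a representation of KZ's RATIONAL shape in
dimension 1 (`isRational_absRep`): the irrational algebraic coefficient `√7` is absorbed into a
rational integrand over a cell with algebraic endpoint. Main results:
`of_oct_sub_of_absRep_mem_relations` (`[octant, 1] ≡ [(0,√7), 49/(96(7+u²))]`, i.e.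
`7√7π/384 = ∫₀^{√7} 49 du/(96(7+u²))` as a chain of five KZ moves) and `octant_bakerDescent` (the
instance `(3, 7/16 − x² − y² − z², 1)` of `QuadricBakerDescent`, stated verbatim in its shape;
`totalDegree_octPoly_le`). Imports: part 3; 0 sorry. [KontsevichZagier2001 §1.2; Baker1975 Thm 2.1]
-/

noncomputable section

open Literature.NumberTheory.Transcendental
open MeasureTheory Set
open MvPolynomial (aeval X C)
open Literature.ModelTheory.ExponentialFields (IsSemialgebraic isSemialgebraic_setOf_eval_pos
  isSemialgebraic_setOf_eval_lt continuous_aeval_real)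
open Summit.KontsevichZagierPeriods.RootDecompWalshStrata.WalshSpanProof (isSemialgebraic_cubeSet
  isBounded_cubeSet cellRep cellRep_domain cellRep_integrand)
open Summit.KontsevichZagierPeriods.RootDecompWalshStrata.ConeSpecimen

namespace Summit.KontsevichZagierPeriods.RootDecompWalshStrata.PointlessOctant

/-! #### The absorption chart `t = u/√7`: `[(0,1), (7√7/96)/(1+t²)] ≡ [(0,√7), 49/(96(7+u²))]` -/

/-- The interval `(0, √7) = {u | 0 < u, u² < 7}` — a `ℚ`-semialgebraic 1-cell. -/
def absDom : Set (Fin 1 → ℝ) := {u | 0 < u 0 ∧ u 0 ^ 2 < 7}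

/-- `(0,√7)` is `ℚ`-semialgebraic. [BCR1998 §2.2] -/
theorem isSemialgebraic_absDom : IsSemialgebraic ℚ absDom := by
  have h := (isSemialgebraic_setOf_eval_lt (R := ℝ) (0 : MvPolynomial (Fin 1) ℚ) (X 0)).inter
    (isSemialgebraic_setOf_eval_lt (R := ℝ) (X 0 ^ 2 : MvPolynomial (Fin 1) ℚ) (C 7))
  have hset : absDom =
      {x : Fin 1 → ℝ | aeval x (0 : MvPolynomial (Fin 1) ℚ) < aeval x (X 0 : MvPolynomial (Fin 1) ℚ)} ∩
      {x : Fin 1 → ℝ | aeval x (X 0 ^ 2 : MvPolynomial (Fin 1) ℚ) <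
        aeval x (C 7 : MvPolynomial (Fin 1) ℚ)} := by
    ext u
    simp [absDom]
  rw [hset]
  exact h

/-- `(0,√7) ⊆ [0,3]`. [folklore] -/
theorem absDom_subset_Icc : absDom ⊆ Icc 0 3 := fun u hu => by
  refine ⟨fun j => ?_, fun j => ?_⟩
  · have : j = 0 := Subsingleton.elim _ _
    subst this
    exact hu.1.le
  · have : j = 0 := Subsingleton.elim _ _
    subst this
    show u 0 ≤ 3
    nlinarith [hu.1, hu.2]

/-- `[(0,√7), 49/(96(7 + u²))]` — a representation of KZ's RATIONAL shape in dimension `1`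
(value `49π/(384√7) = 7√7π/384`): a generator of the Baker sector. [KontsevichZagier2001 §1.1] -/
def absRep : KZ.IntegralRep 1 where
  domain := absDom
  integrand u := 49 / (96 * (7 + u 0 ^ 2))
  isSemialgebraic_domain := isSemialgebraic_absDom
  isSemialgebraicFunOn_integrand :=
    (isSemialgebraicFunOn_aeval_div_aeval isSemialgebraic_absDom (C 49) (C 96 * (C 7 + X 0 ^ 2))
      fun u _ => by
        have h : (0:ℝ) < 96 * (7 + u 0 ^ 2) := by positivity
        simpa using h.ne').congr fun u _ => by
      simp only [map_mul, map_add, map_pow, MvPolynomial.aeval_C, MvPolynomial.aeval_X, eq_ratCast]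
      push_cast
      ring
  integrableOn := by
    refine (ContinuousOn.integrableOn_compact isCompact_Icc ?_).mono_set absDom_subset_Icc
    have hc : Continuous fun u : Fin 1 → ℝ => (49 : ℝ) / (96 * (7 + u 0 ^ 2)) := by
      refine Continuous.div continuous_const ?_ fun u => ?_
      · exact continuous_const.mul (continuous_const.add ((continuous_apply 0).pow 2))
      · positivity
    exact hc.continuousOn

/-- The domain of `absRep`. [folklore] -/
@[simp] theorem absRep_domain : absRep.domain = absDom := rfl

/-- The integrand of `absRep`. [folklore] -/
@[simp] theorem absRep_integrand (u : Fin 1 → ℝ) :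
    absRep.integrand u = 49 / (96 * (7 + u 0 ^ 2)) := rfl

/-- `absRep` has KZ's rational shape. [KontsevichZagier2001 §1.1] -/
theorem isRational_absRep : absRep.IsRational := by
  refine ⟨C 49, C 96 * (C 7 + X 0 ^ 2), fun u _ => ?_, fun u _ => ?_⟩
  · have h : (0:ℝ) < 96 * (7 + u 0 ^ 2) := by positivity
    simpa using h.ne'
  · simp only [absRep_integrand, map_mul, map_add, map_pow, MvPolynomial.aeval_C,
      MvPolynomial.aeval_X, eq_ratCast]
    push_cast
    ring

/-- The absorption chart `u ↦ u/√7` of `ℝ¹`. -/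
def absPhi (u : Fin 1 → ℝ) : Fin 1 → ℝ := (√7)⁻¹ • u

/-- Coordinates of the absorption chart. [folklore] -/
@[simp] theorem absPhi_apply (u : Fin 1 → ℝ) (j : Fin 1) : absPhi u j = (√7)⁻¹ * u j := by
  simp [absPhi, smul_eq_mul]

/-- Its (constant) derivative `(1/√7)·id`. -/
def absPhi' : (Fin 1 → ℝ) →L[ℝ] (Fin 1 → ℝ) := (√7)⁻¹ • ContinuousLinearMap.id ℝ (Fin 1 → ℝ)

/-- The absorption chart is differentiable with derivative `absPhi'`. [calculus] -/
theorem hasFDerivAt_absPhi (u : Fin 1 → ℝ) : HasFDerivAt absPhi absPhi' u :=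
  ((ContinuousLinearMap.id ℝ (Fin 1 → ℝ)).hasFDerivAt.const_smul (√7)⁻¹).congr_fderiv rfl

/-- `det absPhi' = 1/√7`. [folklore] -/
theorem absPhi'_det : absPhi'.det = (√7)⁻¹ := by
  rw [absPhi', ContinuousLinearMap.det, ContinuousLinearMap.toLinearMap_smul,
    ContinuousLinearMap.coe_id, LinearMap.det_smul, LinearMap.det_id, Module.finrank_fin_fun]
  simp

/-- `√(1/7)·u` is `ℚ`-semialgebraic. [BCR1998 §2.2] -/
theorem isSemialgebraicMapOn_absPhi {s : Set (Fin 1 → ℝ)} (hs : IsSemialgebraic ℚ s) :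
    IsSemialgebraicMapOn ℚ s absPhi := by
  refine IsSemialgebraicMapOn.of_forall hs fun j => ?_
  exact (IsSemialgebraicFunOn.mul_holds
    (IsSemialgebraicFunOn.sqrt_holds (isSemialgebraicFunOn_ratCast hs (1 / 7)))
    (isSemialgebraicFunOn_aeval hs (X j))).congr fun u _ => by
      simp only [Pi.mul_apply, MvPolynomial.aeval_X, absPhi_apply]
      push_cast
      rw [one_div, Real.sqrt_inv]

/-- The absorption chart is injective. [folklore] -/
theorem injective_absPhi : Function.Injective absPhi := by
  intro x y h
  have hc : (√7)⁻¹ ≠ (0:ℝ) := inv_ne_zero sqrt7_pos.ne'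
  exact smul_right_injective (Fin 1 → ℝ) hc h

/-- The absorption chart maps `(0,√7)` onto `(0,1)`. [folklore] -/
theorem image_absPhi : absPhi '' absDom = unitIoo := by
  have h7 := sqrt7_mul_self
  have h7p := sqrt7_pos
  ext t
  simp only [mem_image, absDom, mem_setOf_eq, mem_unitIoo]
  constructor
  · rintro ⟨u, ⟨hu0, hu7⟩, rfl⟩
    simp only [absPhi_apply]
    refine ⟨mul_pos (inv_pos.2 h7p) hu0, ?_⟩
    rw [inv_mul_lt_iff₀ h7p, mul_one]
    nlinarith [Real.sq_sqrt (show (0:ℝ) ≤ 7 by norm_num), Real.sqrt_nonneg 7]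
  · rintro ⟨ht0, ht1⟩
    refine ⟨fun _ => √7 * t 0, ⟨mul_pos h7p ht0, ?_⟩, ?_⟩
    · have : (√7 * t 0) ^ 2 = 7 * t 0 ^ 2 := by
        rw [mul_pow, Real.sq_sqrt (by norm_num : (0:ℝ) ≤ 7)]
      rw [this]
      nlinarith
    · funext j
      have : j = 0 := Subsingleton.elim _ _
      subst this
      simp only [absPhi_apply]
      field_simp

/-- **Move (2), the absorption chart:** `[(0,√7), 49/(96(7+u²))] − [(0,1), (7√7/96)/(1+t²)] ∈
relations` along `t = u/√7` (`|det| = 1/√7`; the irrational coefficient `√7` is absorbed into the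
rational integrand and the algebraic endpoint `√7`). [KontsevichZagier2001 §1.2 rule (2)] -/
theorem of_absRep_sub_of_arcRep_mem_relations :
    KZ.of absRep - KZ.of arcRep ∈ KZ.relations := by
  refine KZ.changeOfVariablesRel_subset_relations
    ⟨1, absRep, arcRep, absPhi, fun _ => absPhi', isSemialgebraicMapOn_absPhi isSemialgebraic_absDom,
      fun u _ => (hasFDerivAt_absPhi u).hasFDerivWithinAt, injective_absPhi.injOn, ?_,
      fun u hu => ?_, rfl⟩
  · rw [arcRep_domain, absRep_domain, image_absPhi]
  · have h7 := sqrt7_mul_self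
    have h7p := sqrt7_pos
    have h7ne : √7 ≠ 0 := h7p.ne'
    rw [absRep_integrand, arcRep_integrand, absPhi'_det, abs_of_pos (inv_pos.2 h7p), absPhi_apply]
    have hsq : ((√7)⁻¹ * u 0) ^ 2 = u 0 ^ 2 / 7 := by
      rw [mul_pow, inv_pow, Real.sq_sqrt (by norm_num : (0:ℝ) ≤ 7)]
      ring
    rw [hsq]
    have hden : (0:ℝ) < 7 + u 0 ^ 2 := by positivity
    field_simp
    nlinarith [h7]

/-! #### The pointless octant lands in the Baker sector -/

/-- **`[octant of radius √7/4, 1] ≡ [(0,√7), 49/(96(7+u²))]`:** the pointless ball octant is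
equivalent under the three KZ rules to a RATIONAL one-variable integral
(`7√7·π/384 = ∫₀^{√7} 49 du/(96(7+u²))`). [KontsevichZagier2001 §1.2; this node] -/
theorem of_oct_sub_of_absRep_mem_relations :
    KZ.of (cellRep octPoly 1) - KZ.of absRep ∈ KZ.relations := by
  have h1 := of_octSrc_sub_of_oct_mem_relations
  have h2 := of_octSrc_sub_of_octDisc_mem_relations
  have h3 := of_polRep_sub_of_octDisc_mem_relations
  have h4 := of_polRep_sub_of_arcRep_mem_relations
  have h5 := of_absRep_sub_of_arcRep_mem_relations
  have : KZ.of (cellRep octPoly 1) - KZ.of absRep =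
      -(KZ.of octSrc - KZ.of (cellRep octPoly 1)) + (KZ.of octSrc - KZ.of octDisc) -
        (KZ.of polRep - KZ.of octDisc) + (KZ.of polRep - KZ.of arcRep) -
        (KZ.of absRep - KZ.of arcRep) := by abel
  rw [this]
  exact sub_mem (add_mem (sub_mem (add_mem (neg_mem h1) h2) h3) h4) h5

/-- **The POINTLESS ball octant is an instance of `QuadricBakerDescent`** (`d = 3`,
`P = 7/16 − x² − y² − z²`, `q = 1`): although the quadric `16(x²+y²+z²) = 7` has no rational point
and the value `7√7π/384` has an irrational algebraic coefficient, every representation with this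
domain and integrand `1` is equivalent, modulo `KZ.relations`, to an element of the Baker sector —
the dilation move and the absorption chart dispose of `√7`. Decided INSIDE the rules.
[KontsevichZagier2001 §1.2; this node, critic note 2026-08-30T04:20Z (g4 option 2)] -/
theorem octant_bakerDescent (ρ : KZ.IntegralRep 3)
    (hρ : ρ.domain = {x | (∀ j, 0 < x j ∧ x j < 1) ∧ 0 < MvPolynomial.aeval x octPoly} ∧
      ∀ x ∈ ρ.domain, ρ.integrand x = ((1 : ℚ) : ℝ)) :
    ∃ y ∈ AddSubgroup.closure
        {y : KZ.FormalRep | ∃ (m : ℕ) (N : KZ.IntegralRep m), m ≤ 1 ∧ N.IsRational ∧ y = KZ.of N},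
      KZ.of ρ - y ∈ KZ.relations := by
  refine ⟨KZ.of absRep,
    AddSubgroup.subset_closure ⟨1, absRep, le_rfl, isRational_absRep, rfl⟩, ?_⟩
  have hpin : KZ.of ρ - KZ.of (cellRep octPoly 1) ∈ KZ.relations :=
    KZ.of_sub_of_mem_relations_of_eqOn hρ.1.symm fun x hx => by
      rw [hρ.2 x hx, cellRep_integrand]
  have : KZ.of ρ - KZ.of absRep =
      (KZ.of ρ - KZ.of (cellRep octPoly 1)) + (KZ.of (cellRep octPoly 1) - KZ.of absRep) := by abel
  rw [this]
  exact add_mem hpin of_oct_sub_of_absRep_mem_relations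

/-- `octPoly` has total degree `≤ 2` (so the octant is a QUADRIC Walsh cell, as `QuadricBakerDescent`
requires). -/
theorem totalDegree_octPoly_le : octPoly.totalDegree ≤ 2 := by
  unfold octPoly
  refine (MvPolynomial.totalDegree_sub _ _).trans (max_le ?_ ?_)
  · refine (MvPolynomial.totalDegree_sub _ _).trans (max_le ?_ ?_)
    · refine (MvPolynomial.totalDegree_sub _ _).trans (max_le ?_ ?_)
      · simp
      · exact (MvPolynomial.totalDegree_pow _ _).trans (by simp)
    · exact (MvPolynomial.totalDegree_pow _ _).trans (by simp)
  · exact (MvPolynomial.totalDegree_pow _ _).trans (by simp)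


end Summit.KontsevichZagierPeriods.RootDecompWalshStrata.PointlessOctant

end
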